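import Summits.Ventures.YMGap.Thresholds.OneLinkCasimirTwo
import HarnessLib

/-!
# Venture YMGap — the one-link modulus beyond first order, part 7: the POINTWISE gradient bound of the second-order
# Poisson solution `ψ₂` on `SU(N)`

HONEST FRAMING: venture file of the cell `pub-ymgap` (QuantumFields programme), strong-coupling LATTICE bookkeeping for `SU(N)`
lattice Yang–Mills; nothing about the continuum or the mass gap in the Clay sense.  Pure matrix calculus; no number of record
(«F5», part 1, of the cell note `HOME/p2/ONE-LINK-HIERARCHY.md` §4 (4.5)).

WHAT.  For `ψ₂(Q) = −κ_w Re tr(QΔQB) + κ_t Re(tr(QB)tr(QΔ)) − (1/(4N)) Re(tr(QB) conj tr(QΔ))`, `κ_w = N²/(4(N²−4))`,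
`κ_t = N/(2(N²−4))`, and every direction `A ∈ M_N(ℂ)`, at every `g ∈ SU(N)`:
* `abs_matD_reTrQuad_le`:  `|D_A Re tr(QΔQB)(g)| ≤ 2 ‖B‖_op ‖Δ‖_F ‖A‖_F`;
* `abs_matD_reTrProd_le`, `abs_matD_reTrProdConj_le`:  `|D_A Re(tr(QB) tr(QΔ))(g)|, |D_A Re(tr(QB) conj tr(QΔ))(g)| ≤
  (‖tr(gB)‖ ‖Δ‖_F + ‖tr(gΔ)‖ ‖B‖_F) ‖A‖_F`;
* `abs_matD_psiTwo_le` and, by the frame trick (`sum_sq_apply_frame_le`), `Gam_psiTwo_le`: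
  `Γ(ψ₂,ψ₂)(g) ≤ ( 2κ_w ‖B‖_op ‖Δ‖_F + (κ_t + 1/(4N)) (‖tr(gB)‖ ‖Δ‖_F + ‖tr(gΔ)‖ ‖B‖_F) )²`.
Integrated against `ν_B` with the Schwinger–Dyson means (`OneLinkSDMeans`) and the fluctuation scale (`OneLinkFluctuations`) this
is the `‖∇ψ₂‖_{L²(ν)}` entry of the second-order modulus (cell note (4.5): `≈ ‖Δ‖_F(‖B‖/2 + (3/2) m₁ ‖B‖ + …)` at large `N`).

References: cell note `HOME/p2/ONE-LINK-HIERARCHY.md` §4; Bröcker–tom Dieck GTM 98 II.5.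
-/

noncomputable section

open scoped Matrix ComplexConjugate BigOperators
open Matrix Complex Finset
open Literature.MathematicalPhysics.QuantumFieldTheory
open Literature.MathematicalPhysics.QuantumFieldTheory.SUNBakryEmery

namespace Summit.Ventures.YMGap.OneLinkEigen

variable {N : ℕ}

section Calc

open scoped Matrix.Norms.Frobenius ContDiff Topology

/-- `‖tr(X Y)‖ ≤ ‖X‖_F ‖Y‖_F` (complex modulus; Cauchy–Schwarz for the Hilbert–Schmidt pairing). [folklore] -/
theorem norm_trace_mul_le (X Y : Matrix (Fin N) (Fin N) ℂ) : ‖(X * Y).trace‖ ≤ frobNorm X * frobNorm Y := by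
  set ζ : ℂ := (X * Y).trace with hζ
  by_cases h0 : ζ = 0
  · rw [h0, norm_zero]; exact mul_nonneg (frobNorm_nonneg _) (frobNorm_nonneg _)
  · have hn : (0 : ℝ) < ‖ζ‖ := norm_pos_iff.2 h0
    set c : ℂ := (starRingEnd ℂ) ζ / (‖ζ‖ : ℂ) with hc
    have hcn : ‖c‖ = 1 := by
      rw [hc, norm_div, Complex.norm_conj, Complex.norm_real, Real.norm_eq_abs, abs_of_pos hn, div_self hn.ne']
    have hre : (c * ζ).re = ‖ζ‖ := by
      have : c * ζ = (‖ζ‖ : ℂ) := by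
        rw [hc, div_mul_eq_mul_div, Complex.conj_mul', div_eq_iff (by exact_mod_cast hn.ne'), ← Complex.ofReal_mul, sq]
        simp
      rw [this, Complex.ofReal_re]
    have h1 : (c * ζ).re = ((c • X) * Y).trace.re := by rw [Matrix.smul_mul, trace_smul, smul_eq_mul]
    rw [← hre, h1]
    refine (le_abs_self _).trans ((abs_re_trace_mul_le _ _).trans ?_)
    rw [frobNorm_smul, hcn, one_mul]

/-- `|Re(z w)| ≤ ‖z‖ ‖w‖`. [folklore] -/
theorem abs_re_mul_le_norm_mul_norm (z w : ℂ) : |(z * w).re| ≤ ‖z‖ * ‖w‖ := by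
  rw [← norm_mul]; exact Complex.abs_re_le_norm _

/-- **`|D_A Re tr(QΔQB)(g)| ≤ 2‖B‖_op ‖Δ‖_F ‖A‖_F`** on `SU(N)`. [folklore] -/
theorem abs_matD_reTrQuad_le (A Δ B : Matrix (Fin N) (Fin N) ℂ) (g : SUN N) :
    |matD A (fun Q : Matrix (Fin N) (Fin N) ℂ => (Q * Δ * Q * B).trace.re) g| ≤
      2 * matrixOpNorm B * frobNorm Δ * frobNorm A := by
  have hg := SUN.mem_unitaryGroup g
  set Q : Matrix (Fin N) (Fin N) ℂ := (g : Matrix (Fin N) (Fin N) ℂ) with hQ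
  rw [matD_reTrQuad]
  show |(Q * A * Δ * Q * B).trace.re + (Q * Δ * Q * A * B).trace.re| ≤ _
  have h1 : |(Q * A * Δ * Q * B).trace.re| ≤ matrixOpNorm B * frobNorm Δ * frobNorm A := by
    rw [show Q * A * Δ * Q * B = (Q * A) * (Δ * Q * B) by simp only [Matrix.mul_assoc]]
    refine (abs_re_trace_mul_le _ _).trans ?_
    rw [frobNorm_unitary_mul hg]
    have h2 : frobNorm (Δ * Q * B) ≤ frobNorm Δ * matrixOpNorm B := by
      refine (frobNorm_mul_le_mul_matrixOpNorm _ _).trans ?_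
      rw [frobNorm_mul_unitary _ hg]
    calc frobNorm A * frobNorm (Δ * Q * B) ≤ frobNorm A * (frobNorm Δ * matrixOpNorm B) :=
          mul_le_mul_of_nonneg_left h2 (frobNorm_nonneg _)
      _ = matrixOpNorm B * frobNorm Δ * frobNorm A := by ring
  have h2 : |(Q * Δ * Q * A * B).trace.re| ≤ matrixOpNorm B * frobNorm Δ * frobNorm A := by
    rw [show Q * Δ * Q * A * B = (Q * Δ * Q * A) * B by simp only [Matrix.mul_assoc], trace_mul_comm,
      show B * (Q * Δ * Q * A) = (B * Q * Δ * Q) * A by simp only [Matrix.mul_assoc]]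
    refine (abs_re_trace_mul_le _ _).trans ?_
    have h3 : frobNorm (B * Q * Δ * Q) ≤ matrixOpNorm B * frobNorm Δ := by
      rw [frobNorm_mul_unitary _ hg, show B * Q * Δ = B * (Q * Δ) by simp only [Matrix.mul_assoc]]
      refine (frobNorm_mul_le_matrixOpNorm_mul _ _).trans ?_
      rw [frobNorm_unitary_mul hg]
    exact mul_le_mul_of_nonneg_right h3 (frobNorm_nonneg _)
  calc _ ≤ |(Q * A * Δ * Q * B).trace.re| + |(Q * Δ * Q * A * B).trace.re| := abs_add_le _ _
    _ ≤ _ := by linarith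

/-- The derivative of a product of two linear potentials. [folklore] -/
theorem matD_pot_mul_pot (A M₁ M₂ : Matrix (Fin N) (Fin N) ℂ) (Q : Matrix (Fin N) (Fin N) ℂ) :
    matD A (pot 1 M₁ * pot 1 M₂) Q = (Q * M₁).trace.re * (Q * A * M₂).trace.re + (Q * M₂).trace.re * (Q * A * M₁).trace.re := by
  rw [matD_mul (contDiff_pot 1 M₁) (contDiff_pot 1 M₂)]
  simp only [Pi.add_apply, Pi.mul_apply, pot, one_mul]
  have h : ∀ M : Matrix (Fin N) (Fin N) ℂ, matD A (fun Q : Matrix (Fin N) (Fin N) ℂ => 1 * (Q * M).trace.re) Q = (Q * A * M).trace.re := by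
    intro M; rw [matD_const_mul_reTrMul]; simp
  have h' : ∀ M : Matrix (Fin N) (Fin N) ℂ, matD A (pot 1 M) Q = (Q * A * M).trace.re := h
  rw [h' M₁, h' M₂]

/-- `‖tr(gAM)‖ ≤ ‖A‖_F ‖M‖_F` for unitary `g`. [folklore] -/
theorem norm_trace_su_mul_mul_le (g : SUN N) (A M : Matrix (Fin N) (Fin N) ℂ) :
    ‖((g : Matrix (Fin N) (Fin N) ℂ) * A * M).trace‖ ≤ frobNorm A * frobNorm M := by
  refine (norm_trace_mul_le _ _).trans ?_
  rw [frobNorm_unitary_mul (SUN.mem_unitaryGroup g)]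

/-- **`|D_A Re(tr(QB)tr(QΔ))(g)| ≤ (‖tr(gB)‖ ‖Δ‖_F + ‖tr(gΔ)‖ ‖B‖_F) ‖A‖_F`** on `SU(N)`. [folklore] -/
theorem abs_matD_reTrProd_le (A B Δ : Matrix (Fin N) (Fin N) ℂ) (g : SUN N) :
    |matD A (fun Q : Matrix (Fin N) (Fin N) ℂ => ((Q * B).trace * (Q * Δ).trace).re) g| ≤
      (‖((g : Matrix (Fin N) (Fin N) ℂ) * B).trace‖ * frobNorm Δ + ‖((g : Matrix (Fin N) (Fin N) ℂ) * Δ).trace‖ * frobNorm B)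
        * frobNorm A := by
  set Q : Matrix (Fin N) (Fin N) ℂ := (g : Matrix (Fin N) (Fin N) ℂ) with hQ
  have hA : ContDiff ℝ ∞ (pot 1 B * pot 1 Δ) := (contDiff_pot 1 B).mul (contDiff_pot 1 Δ)
  have hB : ContDiff ℝ ∞ (pot 1 ((-I) • B) * pot 1 ((-I) • Δ)) := (contDiff_pot 1 _).mul (contDiff_pot 1 _)
  rw [reTrProd_eq, matD_sub hA hB, Pi.sub_apply, matD_pot_mul_pot, matD_pot_mul_pot]
  simp only [re_trace_mul_negI_smul]
  -- the expression is Re(z₁ ζ_Δ) + Re(z₂ ζ_B)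
  have e : (Q * B).trace.re * (Q * A * Δ).trace.re + (Q * Δ).trace.re * (Q * A * B).trace.re
      - ((Q * B).trace.im * (Q * A * Δ).trace.im + (Q * Δ).trace.im * (Q * A * B).trace.im) =
      ((Q * B).trace * (Q * A * Δ).trace).re + ((Q * Δ).trace * (Q * A * B).trace).re := by
    simp only [mul_re]; ring
  rw [e]
  have h1 := abs_re_mul_le_norm_mul_norm (Q * B).trace (Q * A * Δ).trace
  have h2 := abs_re_mul_le_norm_mul_norm (Q * Δ).trace (Q * A * B).trace
  have h3 := norm_trace_su_mul_mul_le g A Δ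
  have h4 := norm_trace_su_mul_mul_le g A B
  have h5 : ‖(Q * B).trace‖ * ‖(Q * A * Δ).trace‖ ≤ ‖(Q * B).trace‖ * (frobNorm A * frobNorm Δ) :=
    mul_le_mul_of_nonneg_left h3 (norm_nonneg _)
  have h6 : ‖(Q * Δ).trace‖ * ‖(Q * A * B).trace‖ ≤ ‖(Q * Δ).trace‖ * (frobNorm A * frobNorm B) :=
    mul_le_mul_of_nonneg_left h4 (norm_nonneg _)
  calc _ ≤ |((Q * B).trace * (Q * A * Δ).trace).re| + |((Q * Δ).trace * (Q * A * B).trace).re| := abs_add_le _ _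
    _ ≤ _ := by nlinarith

/-- **`|D_A Re(tr(QB) conj tr(QΔ))(g)| ≤ (‖tr(gB)‖ ‖Δ‖_F + ‖tr(gΔ)‖ ‖B‖_F) ‖A‖_F`** on `SU(N)`. [folklore] -/
theorem abs_matD_reTrProdConj_le (A B Δ : Matrix (Fin N) (Fin N) ℂ) (g : SUN N) :
    |matD A (fun Q : Matrix (Fin N) (Fin N) ℂ => ((Q * B).trace * (starRingEnd ℂ) (Q * Δ).trace).re) g| ≤
      (‖((g : Matrix (Fin N) (Fin N) ℂ) * B).trace‖ * frobNorm Δ + ‖((g : Matrix (Fin N) (Fin N) ℂ) * Δ).trace‖ * frobNorm B)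
        * frobNorm A := by
  set Q : Matrix (Fin N) (Fin N) ℂ := (g : Matrix (Fin N) (Fin N) ℂ) with hQ
  have hA : ContDiff ℝ ∞ (pot 1 B * pot 1 Δ) := (contDiff_pot 1 B).mul (contDiff_pot 1 Δ)
  have hB : ContDiff ℝ ∞ (pot 1 ((-I) • B) * pot 1 ((-I) • Δ)) := (contDiff_pot 1 _).mul (contDiff_pot 1 _)
  rw [reTrProdConj_eq, matD_add hA hB, Pi.add_apply, matD_pot_mul_pot, matD_pot_mul_pot]
  simp only [re_trace_mul_negI_smul]
  -- the expression is Re(conj z₁ · ζ_Δ) + Re(conj z₂ · ζ_B)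
  have e : (Q * B).trace.re * (Q * A * Δ).trace.re + (Q * Δ).trace.re * (Q * A * B).trace.re
      + ((Q * B).trace.im * (Q * A * Δ).trace.im + (Q * Δ).trace.im * (Q * A * B).trace.im) =
      ((starRingEnd ℂ) (Q * B).trace * (Q * A * Δ).trace).re + ((starRingEnd ℂ) (Q * Δ).trace * (Q * A * B).trace).re := by
    simp only [mul_re, conj_re, conj_im]; ring
  rw [e]
  have h1 := abs_re_mul_le_norm_mul_norm ((starRingEnd ℂ) (Q * B).trace) (Q * A * Δ).trace
  have h2 := abs_re_mul_le_norm_mul_norm ((starRingEnd ℂ) (Q * Δ).trace) (Q * A * B).trace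
  rw [Complex.norm_conj] at h1 h2
  have h3 := norm_trace_su_mul_mul_le g A Δ
  have h4 := norm_trace_su_mul_mul_le g A B
  have h5 : ‖(Q * B).trace‖ * ‖(Q * A * Δ).trace‖ ≤ ‖(Q * B).trace‖ * (frobNorm A * frobNorm Δ) :=
    mul_le_mul_of_nonneg_left h3 (norm_nonneg _)
  have h6 : ‖(Q * Δ).trace‖ * ‖(Q * A * B).trace‖ ≤ ‖(Q * Δ).trace‖ * (frobNorm A * frobNorm B) :=
    mul_le_mul_of_nonneg_left h4 (norm_nonneg _)
  calc _ ≤ |((starRingEnd ℂ) (Q * B).trace * (Q * A * Δ).trace).re| + |((starRingEnd ℂ) (Q * Δ).trace * (Q * A * B).trace).re| :=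
        abs_add_le _ _
    _ ≤ _ := by nlinarith

/-- **The pointwise gradient bound of `ψ₂`**: for every direction `A`, at every `g ∈ SU(N)`,
`|D_A ψ₂(g)| ≤ ( 2κ_w ‖B‖_op ‖Δ‖_F + (κ_t + 1/(4N)) (‖tr(gB)‖ ‖Δ‖_F + ‖tr(gΔ)‖ ‖B‖_F) ) ‖A‖_F`. [folklore] -/
theorem abs_matD_psiTwo_le (hN : 3 ≤ N) (B Δ A : Matrix (Fin N) (Fin N) ℂ) (g : SUN N) :
    |matD A (fun Q : Matrix (Fin N) (Fin N) ℂ =>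
        -((N : ℝ) ^ 2 / (4 * ((N : ℝ) ^ 2 - 4))) * (Q * Δ * Q * B).trace.re
          + ((N : ℝ) / (2 * ((N : ℝ) ^ 2 - 4))) * ((Q * B).trace * (Q * Δ).trace).re
          - (1 / (4 * (N : ℝ))) * ((Q * B).trace * (starRingEnd ℂ) (Q * Δ).trace).re) g| ≤
      ((N : ℝ) ^ 2 / (4 * ((N : ℝ) ^ 2 - 4)) * (2 * matrixOpNorm B * frobNorm Δ)
        + ((N : ℝ) / (2 * ((N : ℝ) ^ 2 - 4)) + 1 / (4 * (N : ℝ))) *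
          (‖((g : Matrix (Fin N) (Fin N) ℂ) * B).trace‖ * frobNorm Δ + ‖((g : Matrix (Fin N) (Fin N) ℂ) * Δ).trace‖ * frobNorm B))
        * frobNorm A := by
  have h3 : (3 : ℝ) ≤ N := by exact_mod_cast hN
  have hN4 : (0 : ℝ) < (N : ℝ) ^ 2 - 4 := by nlinarith
  have hNpos : (0 : ℝ) < N := by linarith
  set κw : ℝ := (N : ℝ) ^ 2 / (4 * ((N : ℝ) ^ 2 - 4)) with hκw
  set κt : ℝ := (N : ℝ) / (2 * ((N : ℝ) ^ 2 - 4)) with hκt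
  set c : ℝ := 1 / (4 * (N : ℝ)) with hc
  have hκw0 : 0 ≤ κw := by positivity
  have hκt0 : 0 ≤ κt := by positivity
  have hc0 : 0 ≤ c := by positivity
  have hw := contDiff_reTrQuad (N := N) Δ B
  have ht := contDiff_reTrProd (N := N) B Δ
  have hs := contDiff_reTrProdConj (N := N) B Δ
  have hdec : (fun Q : Matrix (Fin N) (Fin N) ℂ =>
        -κw * (Q * Δ * Q * B).trace.re + κt * ((Q * B).trace * (Q * Δ).trace).re
          - c * ((Q * B).trace * (starRingEnd ℂ) (Q * Δ).trace).re) =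
      fun Q => ((-κw) * (Q * Δ * Q * B).trace.re + κt * ((Q * B).trace * (Q * Δ).trace).re)
        + (-c) * ((Q * B).trace * (starRingEnd ℂ) (Q * Δ).trace).re := by
    funext Q; ring
  have h1 : ContDiff ℝ ∞ fun Q : Matrix (Fin N) (Fin N) ℂ => (-κw) * (Q * Δ * Q * B).trace.re := by
    have h := hw.const_smul (-κw); exact h
  have h2 : ContDiff ℝ ∞ fun Q : Matrix (Fin N) (Fin N) ℂ => κt * ((Q * B).trace * (Q * Δ).trace).re := by
    have h := ht.const_smul κt; exact h
  have h3 : ContDiff ℝ ∞ fun Q : Matrix (Fin N) (Fin N) ℂ => (-c) * ((Q * B).trace * (starRingEnd ℂ) (Q * Δ).trace).re := by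
    have h := hs.const_smul (-c); exact h
  have h12 : ContDiff ℝ ∞ fun Q : Matrix (Fin N) (Fin N) ℂ =>
      (-κw) * (Q * Δ * Q * B).trace.re + κt * ((Q * B).trace * (Q * Δ).trace).re := h1.add h2
  rw [hdec, matD_fun_add h12 h3, matD_fun_add h1 h2, matD_const_mul hw, matD_const_mul ht, matD_const_mul hs]
  have e1 := abs_matD_reTrQuad_le A Δ B g
  have e2 := abs_matD_reTrProd_le A B Δ g
  have e3 := abs_matD_reTrProdConj_le A B Δ g
  have hX : 0 ≤ (‖((g : Matrix (Fin N) (Fin N) ℂ) * B).trace‖ * frobNorm Δ + ‖((g : Matrix (Fin N) (Fin N) ℂ) * Δ).trace‖ * frobNorm B)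
      * frobNorm A :=
    mul_nonneg (add_nonneg (mul_nonneg (norm_nonneg _) (frobNorm_nonneg _)) (mul_nonneg (norm_nonneg _) (frobNorm_nonneg _)))
      (frobNorm_nonneg _)
  have hB0 : 0 ≤ matrixOpNorm B := matrixOpNorm_nonneg B
  have hΔ0 : 0 ≤ frobNorm Δ := frobNorm_nonneg Δ
  have hA0 : 0 ≤ frobNorm A := frobNorm_nonneg A
  calc _ ≤ |(-κw) * matD A (fun Q : Matrix (Fin N) (Fin N) ℂ => (Q * Δ * Q * B).trace.re) g
            + κt * matD A (fun Q : Matrix (Fin N) (Fin N) ℂ => ((Q * B).trace * (Q * Δ).trace).re) g|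
          + |(-c) * matD A (fun Q : Matrix (Fin N) (Fin N) ℂ => ((Q * B).trace * (starRingEnd ℂ) (Q * Δ).trace).re) g| :=
        abs_add_le _ _
    _ ≤ (|(-κw) * matD A (fun Q : Matrix (Fin N) (Fin N) ℂ => (Q * Δ * Q * B).trace.re) g|
          + |κt * matD A (fun Q : Matrix (Fin N) (Fin N) ℂ => ((Q * B).trace * (Q * Δ).trace).re) g|)
          + |(-c) * matD A (fun Q : Matrix (Fin N) (Fin N) ℂ => ((Q * B).trace * (starRingEnd ℂ) (Q * Δ).trace).re) g| := by
        gcongr; exact abs_add_le _ _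
    _ = κw * |matD A (fun Q : Matrix (Fin N) (Fin N) ℂ => (Q * Δ * Q * B).trace.re) g|
          + κt * |matD A (fun Q : Matrix (Fin N) (Fin N) ℂ => ((Q * B).trace * (Q * Δ).trace).re) g|
          + c * |matD A (fun Q : Matrix (Fin N) (Fin N) ℂ => ((Q * B).trace * (starRingEnd ℂ) (Q * Δ).trace).re) g| := by
        rw [abs_mul, abs_mul, abs_mul, abs_neg, abs_neg, abs_of_nonneg hκw0, abs_of_nonneg hκt0, abs_of_nonneg hc0]
    _ ≤ κw * (2 * matrixOpNorm B * frobNorm Δ * frobNorm A)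
          + κt * ((‖((g : Matrix (Fin N) (Fin N) ℂ) * B).trace‖ * frobNorm Δ + ‖((g : Matrix (Fin N) (Fin N) ℂ) * Δ).trace‖ * frobNorm B)
            * frobNorm A)
          + c * ((‖((g : Matrix (Fin N) (Fin N) ℂ) * B).trace‖ * frobNorm Δ + ‖((g : Matrix (Fin N) (Fin N) ℂ) * Δ).trace‖ * frobNorm B)
            * frobNorm A) := by
        gcongr
    _ = _ := by ring

/-- **`Γ(ψ₂, ψ₂)(g) ≤ ( 2κ_w ‖B‖_op ‖Δ‖_F + (κ_t + 1/(4N)) (‖tr(gB)‖ ‖Δ‖_F + ‖tr(gΔ)‖ ‖B‖_F) )²`** on `SU(N)` (frame trick).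
[folklore] -/
theorem Gam_psiTwo_le (hN : 3 ≤ N) (B Δ : Matrix (Fin N) (Fin N) ℂ) (g : SUN N) :
    Gam (fun Q : Matrix (Fin N) (Fin N) ℂ =>
        -((N : ℝ) ^ 2 / (4 * ((N : ℝ) ^ 2 - 4))) * (Q * Δ * Q * B).trace.re
          + ((N : ℝ) / (2 * ((N : ℝ) ^ 2 - 4))) * ((Q * B).trace * (Q * Δ).trace).re
          - (1 / (4 * (N : ℝ))) * ((Q * B).trace * (starRingEnd ℂ) (Q * Δ).trace).re)
      (fun Q : Matrix (Fin N) (Fin N) ℂ =>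
        -((N : ℝ) ^ 2 / (4 * ((N : ℝ) ^ 2 - 4))) * (Q * Δ * Q * B).trace.re
          + ((N : ℝ) / (2 * ((N : ℝ) ^ 2 - 4))) * ((Q * B).trace * (Q * Δ).trace).re
          - (1 / (4 * (N : ℝ))) * ((Q * B).trace * (starRingEnd ℂ) (Q * Δ).trace).re) g ≤
      ((N : ℝ) ^ 2 / (4 * ((N : ℝ) ^ 2 - 4)) * (2 * matrixOpNorm B * frobNorm Δ)
        + ((N : ℝ) / (2 * ((N : ℝ) ^ 2 - 4)) + 1 / (4 * (N : ℝ))) *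
          (‖((g : Matrix (Fin N) (Fin N) ℂ) * B).trace‖ * frobNorm Δ + ‖((g : Matrix (Fin N) (Fin N) ℂ) * Δ).trace‖ * frobNorm B)) ^ 2 := by
  have hN0 : N ≠ 0 := by omega
  rw [Gam_self_eq_sum_sq]
  exact sum_sq_apply_frame_le hN0 (dirFun _ _) fun A => abs_matD_psiTwo_le hN B Δ A g

end Calc

end Summit.Ventures.YMGap.OneLinkEigen
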